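import Summits.CriticalPhenomena.PercolationContinuityZ3.Theorems.SahiCMTP2DensityConverse
import Literature.Probability.LatticeModels.FourFunctionsAE
import Summits.CriticalPhenomena.PercolationContinuityZ3.Theorems.SahiAEFourFunctions

/-!
# Fuchs–Wang (5.1) ⟺ (1.2) on almost every pair: the equivalence for laws with a density

Support file of the Sahi cell (`prim-sahi`, typer seat, generation 19; `--supports stmt-CriticalPhenomena-4575`).
Theorems only (no definitions, no named facts, no sorries).

[FuchsWang2026] §5 leaves "establishing the equivalence between (5.1) and (1.2) when `X_A` has a density `f_{X_A}`
with respect to the product measure" for future research.  Generation 18 proved (1.2)-everywhere ⟹ (5.1)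
(`isCMTP2Set_of_density`) and (5.1) ⟹ (1.2) on `π ⊗ π`-ALMOST EVERY PAIR (`ae_pair_mtp2_of_isCMTP2Set`), leaving the gap
between "almost every pair" and the paper's "some version is mtp₂ everywhere".  With the almost-everywhere four functions
theorem (`SahiAEFourFunctions.lintegral_four_functions_ae`, resting on the diagonal lemma `ae_le_of_ae_pair_le`) the
a.e.-pair form of (1.2) already implies (5.1), so that THE GAP IS IMMATERIAL and the equivalence holds in the following
exact form:

* `isCMTP2Box_of_ae_density`, `isCMTP2Set_of_ae_density` — if the first marginal of `μ` is `π·f` (`π = ⊗ᵢ ρᵢ` σ-finite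
  on `ℝ^A`, `f` measurable), `K` is a version of the conditional law of the second block (`μ^A ⊗ K = μ`), and for all
  `x, y` the function `g(u,z) := K(u)(−∞,z] · f(u)` of (1.2) satisfies `g(u,x) g(v,y) ≤ g(u∧v,x∧y) g(u∨v,x∨y)` for
  `π ⊗ π`-ALMOST EVERY `(u,v)`, then `μ` satisfies the box form of (5.1), and (5.1) itself when `μ` is finite.
* **`isCMTP2Set_iff_ae_pair_mtp2`**, `isCMTP2Box_iff_ae_pair_mtp2` — for finite `ρᵢ`, a finite law `μ` and a Markov
  version `K`: **(5.1) ⟺ (1.2) holds on `π ⊗ π`-almost every pair, for every pair of levels `x, y`**.  The right-hand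
  side does not depend on the version `K` (two versions agree `π·f`-a.e.), so no choice of "versions for which the
  displayed map is mtp₂" is involved: (5.1) is EXACTLY the version-free content of (1.2).  (Whether an a.e.-pair mtp₂
  `g` always admits an everywhere-mtp₂ modification is a separate regularity question about functions, irrelevant to
  every measure-level consequence.)

No sorries, no new axioms.  References: [FuchsWang2026] Def. 1.1, (1.2), §5 (5.1); [KarlinRinott1980] Thm. 2.1;
[MilgromWeber1982] Appendix Thm. 24 (the a.e.-pair form of the density condition).
-/

noncomputable section

namespace Summit.CriticalPhenomena.PercolationContinuityZ3.Theorems.SahiCMTP2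

open MeasureTheory ProbabilityTheory Set Filter Topology Function
open Literature.Probability.LatticeModels Literature.Probability.LatticeModels.Affiliation
open scoped ENNReal SetFamily ProbabilityTheory

variable {ι Y : Type*} [Fintype ι] [MeasurableSpace Y] [Lattice Y] [TopologicalSpace Y] [OpensMeasurableSpace Y]
  [ClosedIicTopology Y]

/-- **[FuchsWang2026] (1.2) on almost every pair ⟹ the box form of (5.1).**  First marginal `π·f` (`π = ⊗ᵢ ρᵢ`
σ-finite, `f` measurable), `K` a disintegration kernel of the second block, and for all levels `x, y` the mtp₂
inequality for `g(u,z) = K(u)(−∞,z] f(u)` on `π ⊗ π`-ALMOST EVERY pair `(u,v)`; then `IsCMTP2Box μ`.  (The a.e. four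
functions theorem with `1_{[a,b]} g(·,x)`, `1_{[a',b']} g(·,y)`, `1_{[a∨a',b∨b']} g(·,x∨y)`, `1_{[a∧a',b∧b']} g(·,x∧y)`.)
[this work] -/
theorem isCMTP2Box_of_ae_density (ρ : ι → Measure ℝ) [∀ i, SigmaFinite (ρ i)] (f : (ι → ℝ) → ℝ≥0∞)
    (hf : Measurable f) (K : Kernel (ι → ℝ) Y) [IsSFiniteKernel K] (μ : Measure ((ι → ℝ) × Y))
    (hfst : μ.fst = (Measure.pi ρ).withDensity f) (hdis : μ.fst ⊗ₘ K = μ)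
    (hmtp : ∀ x y : Y, ∀ᵐ p ∂(Measure.pi ρ).prod (Measure.pi ρ),
      (K p.1 (Iic x) * f p.1) * (K p.2 (Iic y) * f p.2) ≤
        (K (p.1 ⊓ p.2) (Iic (x ⊓ y)) * f (p.1 ⊓ p.2)) * (K (p.1 ⊔ p.2) (Iic (x ⊔ y)) * f (p.1 ⊔ p.2))) :
    IsCMTP2Box μ := by
  intro a b a' b' x y
  set g : Y → (ι → ℝ) → ℝ≥0∞ := fun z u => K u (Iic z) * f u with hg
  have hgm : ∀ z, Measurable (g z) := fun z => (K.measurable_coe measurableSet_Iic).mul hf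
  have hrepr : ∀ (c d : ι → ℝ) (z : Y), μ (Icc c d ×ˢ Iic z) = ∫⁻ u, (Icc c d).indicator (g z) u ∂Measure.pi ρ :=
    fun c d z => prod_Iic_eq_lintegral_indicator (Measure.pi ρ) f hf K μ hfst hdis measurableSet_Icc z
  rw [hrepr, hrepr, hrepr, hrepr]
  have key := Literature.Probability.LatticeModels.lintegral_four_functions_ae ρ ((Icc a b).indicator (g x)) ((Icc a' b').indicator (g y))
    ((Icc (a ⊔ a') (b ⊔ b')).indicator (g (x ⊔ y))) ((Icc (a ⊓ a') (b ⊓ b')).indicator (g (x ⊓ y)))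
    ((hgm x).indicator measurableSet_Icc) ((hgm y).indicator measurableSet_Icc)
    ((hgm _).indicator measurableSet_Icc) ((hgm _).indicator measurableSet_Icc) ?_
  · calc (∫⁻ u, (Icc a b).indicator (g x) u ∂Measure.pi ρ) * (∫⁻ u, (Icc a' b').indicator (g y) u ∂Measure.pi ρ)
        ≤ (∫⁻ u, (Icc (a ⊔ a') (b ⊔ b')).indicator (g (x ⊔ y)) u ∂Measure.pi ρ) *
            (∫⁻ u, (Icc (a ⊓ a') (b ⊓ b')).indicator (g (x ⊓ y)) u ∂Measure.pi ρ) := key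
      _ = _ := mul_comm _ _
  · filter_upwards [hmtp x y] with p hp
    by_cases hu : p.1 ∈ Icc a b
    · by_cases hv : p.2 ∈ Icc a' b'
      · have huv₁ : p.1 ⊔ p.2 ∈ Icc (a ⊔ a') (b ⊔ b') := ⟨sup_le_sup hu.1 hv.1, sup_le_sup hu.2 hv.2⟩
        have huv₂ : p.1 ⊓ p.2 ∈ Icc (a ⊓ a') (b ⊓ b') := ⟨inf_le_inf hu.1 hv.1, inf_le_inf hu.2 hv.2⟩
        rw [indicator_of_mem hu, indicator_of_mem hv, indicator_of_mem huv₁, indicator_of_mem huv₂]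
        exact hp.trans_eq (mul_comm _ _)
      · rw [indicator_of_notMem hv, mul_zero]; exact bot_le
    · rw [indicator_of_notMem hu, zero_mul]; exact bot_le

/-- **[FuchsWang2026] (1.2) on almost every pair ⟹ (5.1)** for a finite law (box form + box criterion). [this work] -/
theorem isCMTP2Set_of_ae_density (ρ : ι → Measure ℝ) [∀ i, SigmaFinite (ρ i)] (f : (ι → ℝ) → ℝ≥0∞)
    (hf : Measurable f) (K : Kernel (ι → ℝ) Y) [IsSFiniteKernel K] (μ : Measure ((ι → ℝ) × Y)) [IsFiniteMeasure μ]
    (hfst : μ.fst = (Measure.pi ρ).withDensity f) (hdis : μ.fst ⊗ₘ K = μ)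
    (hmtp : ∀ x y : Y, ∀ᵐ p ∂(Measure.pi ρ).prod (Measure.pi ρ),
      (K p.1 (Iic x) * f p.1) * (K p.2 (Iic y) * f p.2) ≤
        (K (p.1 ⊓ p.2) (Iic (x ⊓ y)) * f (p.1 ⊓ p.2)) * (K (p.1 ⊔ p.2) (Iic (x ⊔ y)) * f (p.1 ⊔ p.2))) :
    IsCMTP2Set μ :=
  isCMTP2Set_of_isCMTP2Box μ (isCMTP2Box_of_ae_density ρ f hf K μ hfst hdis hmtp)

/-- **[FuchsWang2026] §5: the box form of (5.1) ⟺ (1.2) on almost every pair.**  First marginal `π·f` with `π = ⊗ᵢ ρᵢ`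
finite, `μ` finite, `K` a Markov version of the conditional law of the second block: `IsCMTP2Box μ` if and only if, for
all levels `x, y`, `g(u,x) g(v,y) ≤ g(u∧v,x∧y) g(u∨v,x∨y)` for `π ⊗ π`-a.e. `(u,v)`, `g(u,z) = K(u)(−∞,z] f(u)`.
[this work] -/
theorem isCMTP2Box_iff_ae_pair_mtp2 (ρ : ι → Measure ℝ) [∀ i, IsFiniteMeasure (ρ i)] (f : (ι → ℝ) → ℝ≥0∞)
    (hf : Measurable f) (K : Kernel (ι → ℝ) Y) [IsMarkovKernel K] (μ : Measure ((ι → ℝ) × Y)) [IsFiniteMeasure μ]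
    (hfst : μ.fst = (Measure.pi ρ).withDensity f) (hdis : μ.fst ⊗ₘ K = μ) :
    IsCMTP2Box μ ↔ ∀ x y : Y, ∀ᵐ p ∂(Measure.pi ρ).prod (Measure.pi ρ),
      (K p.1 (Iic x) * f p.1) * (K p.2 (Iic y) * f p.2) ≤
        (K (p.1 ⊓ p.2) (Iic (x ⊓ y)) * f (p.1 ⊓ p.2)) * (K (p.1 ⊔ p.2) (Iic (x ⊔ y)) * f (p.1 ⊔ p.2)) :=
  ⟨fun h x y => ae_pair_mtp2_of_isCMTP2Box ρ f hf K μ hfst hdis h x y,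
    fun h => isCMTP2Box_of_ae_density ρ f hf K μ hfst hdis h⟩

/-- **[FuchsWang2026] §5, the equivalence asked for: (5.1) ⟺ (1.2) on almost every pair** — `cMTP₂^set(X_B | X_A)` holds
if and only if the map `(x_A, x_B) ↦ P(X_B ≤ x_B | X_A = x_A) f_{X_A}(x_A)` of (1.2) satisfies the mtp₂ inequality for
every pair of levels `x_B, x_B'` and ALMOST EVERY pair `(x_A, x_A')` (with respect to `π ⊗ π`, `π` the product reference
measure), for any — equivalently every — version of the conditional law.  Setting: `π = ⊗ᵢ ρᵢ` finite measures on `ℝ`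
(e.g. the paper's `⊗ P^{X_i}`), `μ` finite with first marginal `π·f`, `K` Markov with `μ^A ⊗ K = μ`. [this work] -/
theorem isCMTP2Set_iff_ae_pair_mtp2 (ρ : ι → Measure ℝ) [∀ i, IsFiniteMeasure (ρ i)] (f : (ι → ℝ) → ℝ≥0∞)
    (hf : Measurable f) (K : Kernel (ι → ℝ) Y) [IsMarkovKernel K] (μ : Measure ((ι → ℝ) × Y)) [IsFiniteMeasure μ]
    (hfst : μ.fst = (Measure.pi ρ).withDensity f) (hdis : μ.fst ⊗ₘ K = μ) :
    IsCMTP2Set μ ↔ ∀ x y : Y, ∀ᵐ p ∂(Measure.pi ρ).prod (Measure.pi ρ),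
      (K p.1 (Iic x) * f p.1) * (K p.2 (Iic y) * f p.2) ≤
        (K (p.1 ⊓ p.2) (Iic (x ⊓ y)) * f (p.1 ⊓ p.2)) * (K (p.1 ⊔ p.2) (Iic (x ⊔ y)) * f (p.1 ⊔ p.2)) :=
  ⟨fun h x y => ae_pair_mtp2_of_isCMTP2Set ρ f hf K μ hfst hdis h x y,
    fun h => isCMTP2Set_of_ae_density ρ f hf K μ hfst hdis h⟩

end Summit.CriticalPhenomena.PercolationContinuityZ3.Theorems.SahiCMTP2
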